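import Literature.MathematicalPhysics.QuantumLattice.LiebRobinsonFnwGapGramProofs
import HarnessLib

/-!
# The cross Gram pairing of a left and a right MPS family (FNW Lemma 6.2, first half)

Sibling proof file of `Literature/MathematicalPhysics/QuantumLattice/LiebRobinson.lean`
(theorem-only: no definition, no named fact), a step towards the discharge of
`fannes_nachtergaele_werner_gap` (**hubbard.S16**; Fannes–Nachtergaele–Werner 1992, Thm. 6.4),
continuing `LiebRobinsonFnwGapGramProofs.lean` (normalised gauge `𝔼(𝟙) = 𝟙`, `𝔼†(ρ) = ρ`,
`λ 𝟙 ≤ ρ ≤ 𝟙`; convergence of `𝔼ⁿ` as the entrywise hypothesis `|𝔼ⁿ(e_a e_dᵀ) - ρ_{da} 𝟙| ≤ δ`).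

* `norm_cross_sub_trace_le` — for a left family `B_t` and a right family `C_u` of boundary
  matrices, `Σ_{u,s,t} conj tr (B_t A^{u} A^{s}) · tr (C_u A^{s} A^{t}) = tr (Θ Δ) + E` with
  `Θ = Σ_t B_tᴴ ρ A^{t}`, `Δ = Σ_u C_u A^{u}†`, `|E| ≤ δ D² √(λ⁻¹ Σ_u ‖C_u‖₂²) √(Σ_t ‖B_t‖₂²)`
  (FNW eq. (6.5));
* `mul_sum_norm_sq_le_sum_norm_trace_sq` — `Σ_{|w|=n} |tr (B A^{w})|² ≥ (λ/2) ‖B‖₂²` when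
  `δ D² ≤ λ/2` (FNW: `‖Γ_n(B)‖² = tr (ρ …) + O(a(n))`, Lemma 5.2 (2));
* real helpers `sqrt_le_of_le_mul_sqrt`, `sum_sqrt_mul_sqrt_le`, `sum_norm_le_mul_sqrt`,
  `sum_sum_norm_sq_conjTranspose`, `norm_sq_eq_re_star_mul_self`, `sum_sum_eq_sum_append`.

## Source

* M. Fannes, B. Nachtergaele, R. F. Werner, Comm. Math. Phys. **144** (1992) 443–490, §5
  Lemma 5.2 and §6, proof of Lemma 6.2 (p. 476–477, eq. (6.5)). [FannesNachtergaeleWernerCMP1992]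
-/

noncomputable section

open Matrix
open scoped ComplexOrder MatrixOrder

namespace Literature.MathematicalPhysics.QuantumLattice

section QLattice

variable {q D : ℕ}

/-! ### Real helpers -/

/-- `x ≤ K √x` forces `√x ≤ K` (`K ≥ 0`). [folklore] -/
theorem sqrt_le_of_le_mul_sqrt {x K : ℝ} (hK : 0 ≤ K) (h : x ≤ K * Real.sqrt x) :
    Real.sqrt x ≤ K := by
  rcases le_or_gt x 0 with hx | hx
  · rw [Real.sqrt_eq_zero'.2 hx]; exact hK
  · have hs : 0 < Real.sqrt x := Real.sqrt_pos.2 hx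
    have hx' : Real.sqrt x * Real.sqrt x = x := Real.mul_self_sqrt hx.le
    nlinarith

/-- Cauchy–Schwarz with square roots: `Σ √(x_i) √(y_i) ≤ √(Σ x_i) √(Σ y_i)` for `x, y ≥ 0`.
[folklore] -/
theorem sum_sqrt_mul_sqrt_le {ι : Type*} (s : Finset ι) {x y : ι → ℝ} (hx : ∀ i ∈ s, 0 ≤ x i)
    (hy : ∀ i ∈ s, 0 ≤ y i) :
    ∑ i ∈ s, Real.sqrt (x i) * Real.sqrt (y i) ≤
      Real.sqrt (∑ i ∈ s, x i) * Real.sqrt (∑ i ∈ s, y i) := by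
  have h := Finset.sum_mul_sq_le_sq_mul_sq s (fun i => Real.sqrt (x i)) (fun i => Real.sqrt (y i))
  have ex : ∑ i ∈ s, Real.sqrt (x i) ^ 2 = ∑ i ∈ s, x i :=
    Finset.sum_congr rfl fun i hi => Real.sq_sqrt (hx i hi)
  have ey : ∑ i ∈ s, Real.sqrt (y i) ^ 2 = ∑ i ∈ s, y i :=
    Finset.sum_congr rfl fun i hi => Real.sq_sqrt (hy i hi)
  rw [ex, ey] at h
  rw [← Real.sqrt_mul (Finset.sum_nonneg hx), ← Real.sqrt_sq (Finset.sum_nonneg fun i hi =>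
    mul_nonneg (Real.sqrt_nonneg _) (Real.sqrt_nonneg _))]
  exact Real.sqrt_le_sqrt h

/-- `Σ |X_{ij}| ≤ D √(Σ |X_{ij}|²)`. [folklore] -/
theorem sum_norm_le_mul_sqrt (X : Matrix (Fin D) (Fin D) ℂ) :
    ∑ i, ∑ j, ‖X i j‖ ≤ (D : ℝ) * Real.sqrt (∑ i, ∑ j, ‖X i j‖ ^ 2) := by
  have h := sum_norm_sq_le X
  have h0 : 0 ≤ ∑ i, ∑ j, ‖X i j‖ := Finset.sum_nonneg fun i _ =>
    Finset.sum_nonneg fun j _ => norm_nonneg _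
  rw [← Real.sqrt_le_sqrt_iff (by positivity), Real.sqrt_sq h0, Real.sqrt_mul (by positivity),
    Real.sqrt_sq (by positivity)] at h
  exact h

/-- The Hilbert–Schmidt norm is invariant under the adjoint. [folklore] -/
theorem sum_sum_norm_sq_conjTranspose (X : Matrix (Fin D) (Fin D) ℂ) :
    ∑ i, ∑ j, ‖Xᴴ i j‖ ^ 2 = ∑ i, ∑ j, ‖X i j‖ ^ 2 := by
  rw [Finset.sum_comm]
  simp [conjTranspose_apply]

/-- Sums over pairs of words are sums over the concatenated words. [folklore] -/
theorem sum_sum_eq_sum_append {M : Type*} [AddCommMonoid M] {m n : ℕ}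
    (f : (Fin (m + n) → Fin q) → M) :
    ∑ u : Fin m → Fin q, ∑ v : Fin n → Fin q, f (Fin.append u v) = ∑ w : Fin (m + n) → Fin q, f w := by
  rw [← Fintype.sum_prod_type']
  exact Fintype.sum_equiv (Fin.appendEquiv m n) (fun p => f (Fin.append p.1 p.2)) f fun p => rfl

/-! ### The cross pairing of a left family and a right family -/

/-- **Decomposition of the cross Gram pairing** (the computation in the proof of
Fannes–Nachtergaele–Werner's Lemma 6.2): for families `B_t` (`t` a word of length `c`) and `C_u`
(`u` a word of length `a`) of boundary matrices,
`Σ_{u,s,t} conj tr (B_t A^u A^s) · tr (C_u A^s A^t) = tr (Θ Δ) + E` with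
`Θ = Σ_t B_tᴴ ρ A^t`, `Δ = Σ_u C_u A^u†`, and the remainder of the middle Gram sums is bounded by
`|E| ≤ δ D² √(λ⁻¹ Σ_u ‖C_u‖₂²) √(Σ_t ‖B_t‖₂²)` when the entries of `𝔼ᵇ(e_a e_dᵀ) - ρ_{da} 𝟙` are
`≤ δ` (normalised gauge, `λ 𝟙 ≤ ρ ≤ 𝟙`). FNW (1992), proof of Lemma 6.2, eq. (6.5).
[cite: FannesNachtergaeleWernerCMP1992, Lemma 6.2] -/
theorem norm_cross_sub_trace_le (A : MPSTensor q D) {ρ : Matrix (Fin D) (Fin D) ℂ}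
    (h1 : transferOp A 1 = 1) (hρ : transferOp (fun i => (A i)ᴴ) ρ = ρ)
    (hρ1 : (1 - ρ).PosSemidef) {lam : ℝ} (hlam : 0 < lam)
    (hlamρ : (ρ - (lam : ℂ) • (1 : Matrix (Fin D) (Fin D) ℂ)).PosSemidef)
    {a b c : ℕ} {δ : ℝ} (hδ0 : 0 ≤ δ)
    (hδ : ∀ a' d' i j : Fin D, ‖((transferOp A ^ b) (Matrix.single a' d' 1) -
      ρ d' a' • (1 : Matrix (Fin D) (Fin D) ℂ)) i j‖ ≤ δ)
    (B : (Fin c → Fin q) → Matrix (Fin D) (Fin D) ℂ)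
    (C : (Fin a → Fin q) → Matrix (Fin D) (Fin D) ℂ) :
    ‖(∑ u : Fin a → Fin q, ∑ s : Fin b → Fin q, ∑ t : Fin c → Fin q,
        star ((B t * wordProduct A u * wordProduct A s).trace) *
          (C u * wordProduct A s * wordProduct A t).trace) -
      ((∑ t : Fin c → Fin q, (B t)ᴴ * ρ * wordProduct A t) *
        (∑ u : Fin a → Fin q, C u * (wordProduct A u)ᴴ)).trace‖ ≤
      δ * (D : ℝ) ^ 2 * Real.sqrt (lam⁻¹ * ∑ u, ∑ i, ∑ j, ‖C u i j‖ ^ 2) *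
        Real.sqrt (∑ t, ∑ i, ∑ j, ‖B t i j‖ ^ 2) := by
  -- abbreviations
  set R : Fin D → Fin D → Matrix (Fin D) (Fin D) ℂ := fun a' d' =>
    (transferOp A ^ b) (Matrix.single a' d' 1) - ρ d' a' • (1 : Matrix (Fin D) (Fin D) ℂ) with hR
  set rem : (Fin a → Fin q) → (Fin c → Fin q) → ℂ := fun u t =>
    ∑ a' : Fin D, ∑ d' : Fin D,
      (wordProduct A t * C u * R a' d' * (B t * wordProduct A u)ᴴ) a' d' with hrem
  -- Step 1: the middle Gram sum, per `(u, t)`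
  have hmid : ∀ (u : Fin a → Fin q) (t : Fin c → Fin q),
      ∑ s : Fin b → Fin q, star ((B t * wordProduct A u * wordProduct A s).trace) *
          (C u * wordProduct A s * wordProduct A t).trace =
        ((B t * wordProduct A u)ᴴ * ρ * (wordProduct A t * C u)).trace + rem u t := by
    intro u t
    have e : ∀ s : Fin b → Fin q, (C u * wordProduct A s * wordProduct A t).trace =
        (wordProduct A t * C u * wordProduct A s).trace := fun s => trace_mul_cycle _ _ _
    simp only [e]
    exact sum_conj_trace_mul_trace_eq_main_add A b ρ (B t * wordProduct A u) (wordProduct A t * C u)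
  -- Step 2: the main terms sum to `tr (Θ Δ)`
  have hmain : ∑ u : Fin a → Fin q, ∑ t : Fin c → Fin q,
      ((B t * wordProduct A u)ᴴ * ρ * (wordProduct A t * C u)).trace =
      ((∑ t : Fin c → Fin q, (B t)ᴴ * ρ * wordProduct A t) *
        (∑ u : Fin a → Fin q, C u * (wordProduct A u)ᴴ)).trace := by
    rw [Finset.sum_mul, trace_sum, Finset.sum_comm]
    refine Finset.sum_congr rfl fun t _ => ?_
    rw [Finset.mul_sum, trace_sum]
    refine Finset.sum_congr rfl fun u _ => ?_
    rw [conjTranspose_mul, Matrix.mul_assoc, Matrix.mul_assoc, Matrix.mul_assoc, trace_mul_comm]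
    simp only [Matrix.mul_assoc]
  -- Step 3: reorganise the triple sum and subtract
  have hLHS : (∑ u : Fin a → Fin q, ∑ s : Fin b → Fin q, ∑ t : Fin c → Fin q,
        star ((B t * wordProduct A u * wordProduct A s).trace) *
          (C u * wordProduct A s * wordProduct A t).trace) -
      ((∑ t : Fin c → Fin q, (B t)ᴴ * ρ * wordProduct A t) *
        (∑ u : Fin a → Fin q, C u * (wordProduct A u)ᴴ)).trace =
      ∑ u : Fin a → Fin q, ∑ t : Fin c → Fin q, rem u t := by
    rw [← hmain, ← Finset.sum_sub_distrib]
    refine Finset.sum_congr rfl fun u _ => ?_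
    rw [Finset.sum_comm, ← Finset.sum_sub_distrib]
    refine Finset.sum_congr rfl fun t _ => ?_
    rw [hmid, add_sub_cancel_left]
  rw [hLHS]
  -- Step 4: bound each remainder
  have hrem_le : ∀ (u : Fin a → Fin q) (t : Fin c → Fin q), ‖rem u t‖ ≤
      δ * (D : ℝ) ^ 2 * (Real.sqrt (∑ i, ∑ j, ‖(wordProduct A t * C u) i j‖ ^ 2) *
        Real.sqrt (∑ i, ∑ j, ‖(B t * wordProduct A u) i j‖ ^ 2)) := by
    intro u t
    have h := norm_gram_remainder_le A b ρ hδ (B t * wordProduct A u) (wordProduct A t * C u)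
    refine h.trans ?_
    have h2 := sum_norm_le_mul_sqrt (wordProduct A t * C u)
    have h3 := sum_norm_le_mul_sqrt (B t * wordProduct A u)
    have h4 := mul_le_mul h2 h3 (Finset.sum_nonneg fun i _ => Finset.sum_nonneg fun j _ =>
      norm_nonneg _) (by positivity)
    calc δ * (∑ i, ∑ j, ‖(wordProduct A t * C u) i j‖) * (∑ i, ∑ j, ‖(B t * wordProduct A u) i j‖)
        = δ * ((∑ i, ∑ j, ‖(wordProduct A t * C u) i j‖) *
            (∑ i, ∑ j, ‖(B t * wordProduct A u) i j‖)) := by ring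
      _ ≤ δ * ((D : ℝ) * Real.sqrt (∑ i, ∑ j, ‖(wordProduct A t * C u) i j‖ ^ 2) *
            ((D : ℝ) * Real.sqrt (∑ i, ∑ j, ‖(B t * wordProduct A u) i j‖ ^ 2))) :=
          mul_le_mul_of_nonneg_left h4 hδ0
      _ = _ := by ring
  -- Step 5: sum the bounds with Cauchy–Schwarz over the pairs `(u, t)`
  have hsumB : ∑ p : (Fin a → Fin q) × (Fin c → Fin q),
      ∑ i, ∑ j, ‖(B p.2 * wordProduct A p.1) i j‖ ^ 2 = ∑ t, ∑ i, ∑ j, ‖B t i j‖ ^ 2 := by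
    rw [Fintype.sum_prod_type, Finset.sum_comm]
    exact Finset.sum_congr rfl fun t _ => sum_sum_norm_sq_mul_wordProduct A h1 a (B t)
  have hsumC : ∑ p : (Fin a → Fin q) × (Fin c → Fin q),
      ∑ i, ∑ j, ‖(wordProduct A p.2 * C p.1) i j‖ ^ 2 ≤ lam⁻¹ * ∑ u, ∑ i, ∑ j, ‖C u i j‖ ^ 2 := by
    rw [Fintype.sum_prod_type, Finset.mul_sum]
    exact Finset.sum_le_sum fun u _ => sum_sum_norm_sq_wordProduct_mul_le A hρ hρ1 hlam hlamρ c (C u)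
  calc ‖∑ u : Fin a → Fin q, ∑ t : Fin c → Fin q, rem u t‖
      ≤ ∑ u : Fin a → Fin q, ∑ t : Fin c → Fin q, ‖rem u t‖ :=
        (norm_sum_le _ _).trans (Finset.sum_le_sum fun u _ => norm_sum_le _ _)
    _ ≤ ∑ u : Fin a → Fin q, ∑ t : Fin c → Fin q,
          δ * (D : ℝ) ^ 2 * (Real.sqrt (∑ i, ∑ j, ‖(wordProduct A t * C u) i j‖ ^ 2) *
            Real.sqrt (∑ i, ∑ j, ‖(B t * wordProduct A u) i j‖ ^ 2)) :=
        Finset.sum_le_sum fun u _ => Finset.sum_le_sum fun t _ => hrem_le u t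
    _ = δ * (D : ℝ) ^ 2 * ∑ p : (Fin a → Fin q) × (Fin c → Fin q),
          Real.sqrt (∑ i, ∑ j, ‖(wordProduct A p.2 * C p.1) i j‖ ^ 2) *
            Real.sqrt (∑ i, ∑ j, ‖(B p.2 * wordProduct A p.1) i j‖ ^ 2) := by
        rw [Fintype.sum_prod_type, Finset.mul_sum]
        exact Finset.sum_congr rfl fun u _ => by rw [Finset.mul_sum]
    _ ≤ δ * (D : ℝ) ^ 2 * (Real.sqrt (∑ p : (Fin a → Fin q) × (Fin c → Fin q),
          ∑ i, ∑ j, ‖(wordProduct A p.2 * C p.1) i j‖ ^ 2) *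
          Real.sqrt (∑ p : (Fin a → Fin q) × (Fin c → Fin q),
            ∑ i, ∑ j, ‖(B p.2 * wordProduct A p.1) i j‖ ^ 2)) := by
        refine mul_le_mul_of_nonneg_left (sum_sqrt_mul_sqrt_le _ (fun p _ => by positivity)
          (fun p _ => by positivity)) (by positivity)
    _ ≤ δ * (D : ℝ) ^ 2 * (Real.sqrt (lam⁻¹ * ∑ u, ∑ i, ∑ j, ‖C u i j‖ ^ 2) *
          Real.sqrt (∑ t, ∑ i, ∑ j, ‖B t i j‖ ^ 2)) := by
        rw [hsumB]
        exact mul_le_mul_of_nonneg_left (mul_le_mul_of_nonneg_right (Real.sqrt_le_sqrt hsumC)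
          (Real.sqrt_nonneg _)) (by positivity)
    _ = _ := by ring

/-! ### Norms of vectors with MPS slices -/

/-- `|z|² = re (z̄ z)`. [folklore] -/
theorem norm_sq_eq_re_star_mul_self (z : ℂ) : ‖z‖ ^ 2 = (star z * z).re := by
  rw [Complex.star_def, mul_comm, Complex.mul_conj, Complex.ofReal_re, Complex.normSq_eq_norm_sq]

/-- **Lower bound for the Gram form in the normalised gauge** (Fannes–Nachtergaele–Werner
Lemma 5.2 / proof of Lemma 6.2: `‖Γ_n(B)‖² ≥ a_-(n) tr (B ρ B†)`): if the entries of
`𝔼ⁿ(e_a e_dᵀ) - ρ_{da} 𝟙` are `≤ δ` with `δ D² ≤ λ/2` and `ρ ≥ λ 𝟙`, then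
`Σ_{|w|=n} |tr (B A^{w})|² ≥ (λ/2) Σ |B_{ij}|²`. [cite: FannesNachtergaeleWernerCMP1992, §5 Lemma 5.2] -/
theorem mul_sum_norm_sq_le_sum_norm_trace_sq (A : MPSTensor q D) {ρ : Matrix (Fin D) (Fin D) ℂ}
    {lam : ℝ} (hlamρ : (ρ - (lam : ℂ) • (1 : Matrix (Fin D) (Fin D) ℂ)).PosSemidef)
    {n : ℕ} {δ : ℝ} (hδ0 : 0 ≤ δ) (hδlam : δ * (D : ℝ) ^ 2 ≤ lam / 2)
    (hδ : ∀ a' d' i j : Fin D, ‖((transferOp A ^ n) (Matrix.single a' d' 1) -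
      ρ d' a' • (1 : Matrix (Fin D) (Fin D) ℂ)) i j‖ ≤ δ)
    (B : Matrix (Fin D) (Fin D) ℂ) :
    lam / 2 * ∑ i, ∑ j, ‖B i j‖ ^ 2 ≤
      ∑ w : Fin n → Fin q, ‖(B * wordProduct A w).trace‖ ^ 2 := by
  have hsum : ∑ w : Fin n → Fin q, ‖(B * wordProduct A w).trace‖ ^ 2 =
      (∑ w : Fin n → Fin q, star ((B * wordProduct A w).trace) * (B * wordProduct A w).trace).re := by
    rw [Complex.re_sum]
    exact Finset.sum_congr rfl fun w _ => norm_sq_eq_re_star_mul_self _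
  rw [hsum, sum_conj_trace_mul_trace_eq_main_add A n ρ B B, Complex.add_re]
  have hmain := mul_sum_norm_sq_le_re_trace hlamρ B
  have hrem := norm_gram_remainder_le A n ρ hδ B B
  have hrem' : -(δ * (∑ i, ∑ j, ‖B i j‖) * (∑ i, ∑ j, ‖B i j‖)) ≤
      (∑ a' : Fin D, ∑ d' : Fin D, (B * ((transferOp A ^ n) (Matrix.single a' d' 1) -
        ρ d' a' • (1 : Matrix (Fin D) (Fin D) ℂ)) * Bᴴ) a' d').re :=
    (neg_le_neg hrem).trans (abs_le.1 (Complex.abs_re_le_norm _)).1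
  have hsq := sum_norm_sq_le B
  have h0 : 0 ≤ ∑ i, ∑ j, ‖B i j‖ ^ 2 := by positivity
  have h1 : δ * ((∑ i, ∑ j, ‖B i j‖) * (∑ i, ∑ j, ‖B i j‖)) ≤ δ * ((D : ℝ) ^ 2 * ∑ i, ∑ j, ‖B i j‖ ^ 2) :=
    mul_le_mul_of_nonneg_left (by rw [← sq]; exact hsq) hδ0
  have h2 : δ * ((D : ℝ) ^ 2 * ∑ i, ∑ j, ‖B i j‖ ^ 2) ≤ lam / 2 * ∑ i, ∑ j, ‖B i j‖ ^ 2 := by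
    rw [← mul_assoc]; exact mul_le_mul_of_nonneg_right hδlam h0
  linarith

end QLattice

end Literature.MathematicalPhysics.QuantumLattice
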